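import Literature.AlgebraicGeometry.HodgeTheory.HypersurfaceHolomorphicForms
import Literature.Geometry.Kaehler.HolomorphicChartForms
import HarnessLib

/-!
# `p_g ≥ 1` for smooth hypersurfaces of degree `d ≥ m + 2`: reduction of
`Hartshorne1977_hypersurface_exists_holomorphicTopForm` to the analytic geometric genus

Family `hodge`, layer `Literature/AlgebraicGeometry/HodgeTheory`. The named fact
`Hartshorne1977_hypersurface_exists_holomorphicTopForm` (file `HypersurfaceHolomorphicForms`)
asks, for a smooth hypersurface `Y ⊂ ℙ^{m+1}_ℂ` of degree `d ≥ m + 2` and a Hodge model `A` of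
`Y`, for a smooth, closed, non-zero complex `m`-form of type `(m,0)` on `A.carrier`. In print
this is two results of different nature:

* (G) **geometry** — Hartshorne II, Example 8.20.3: `ω_Y ≅ 𝒪_Y(d-m-2)`, so `p_g(Y) ≥ 1` for
  `d ≥ m + 2`; with Serre's GAGA (Hartshorne App. B, Thm. 2.1: `H⁰(Y, ω_Y) ≅ H⁰(Y_h, (ω_Y)_h)`,
  and `(Ω^m_Y)_h = Ω^m_{Y_h}`) the analytification `Y_h` — hence the carrier of every Hodge
  model, an analytification with holomorphic atlas — carries a non-zero holomorphic `m`-form.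
  Vendored here as the named fact `Hartshorne1977_hypersurface_geometricGenus_pos`, with
  "holomorphic `m`-form" in the local-coordinate sense
  `Literature.Geometry.Kaehler.IsHolomorphicInCharts` (Huybrechts, Def. 2.2.14), the form an
  explicit construction (Griffiths residues `Res_Y(PΩ/F)`, Voisin II §6.1.3) produces;
* (B) **complex differential geometry** — a holomorphic `m`-form on an `m`-dimensional complex
  manifold is a smooth closed `(m,0)`-form (Voisin I, proof of Cor. 7.6, case `p = n`), PROVED in
  `Literature/Geometry/Kaehler/HolomorphicChartForms`
  (`IsHolomorphicInCharts.isSmoothForm/isOfType/isClosedForm`).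

`Hartshorne1977_hypersurface_exists_holomorphicTopForm_of_geometricGenus_pos` (proved) assembles
(G) and (B): the discharge of the original fact is thereby reduced to the discharge of (G), a
programme in algebraic geometry on Mathlib's schemes (canonical sheaf and adjunction, or the
Jacobian criterion and Poincaré residues on the analytification), recorded in the docstring of
the fact.

## References

* R. Hartshorne, *Algebraic Geometry* (1977), II, Prop. 8.20, Example 8.20.3; App. B, Thm. 2.1.
* J.-P. Serre, *Géométrie algébrique et géométrie analytique*, Ann. Inst. Fourier 6 (1956), §3.
* C. Voisin, *Hodge Theory and Complex Algebraic Geometry I* (2002), Cor. 7.6; *II* (2003), §6.1.3.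
* D. Huybrechts, *Complex Geometry* (2005), Def. 2.2.14.
-/

noncomputable section

open scoped Manifold ContDiff

namespace Literature.AlgebraicGeometry.HodgeTheory

/-- **Smooth hypersurfaces of degree `d ≥ m + 2` have positive geometric genus, analytically**
(named fact). In print: for a nonsingular hypersurface `Y` of degree `d` in `ℙⁿ`,
`ω_Y ≅ 𝒪_Y(d-n-1)` (Hartshorne II, Prop. 8.20 with Example 8.20.1), hence for `d ≥ n + 1`
"`p_g(Y) ≥ 1`" (Example 8.20.3; `n` = our `m + 1`); by Serre's GAGA comparison
`H⁰(Y, ω_Y) ≅ H⁰(Y_h, (ω_Y)_h)` for the projective `Y` (Hartshorne App. B, Thm. 2.1) and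
`(ω_Y)_h = Ω^m_{Y_h}`, the associated complex manifold `Y_h` carries a non-zero holomorphic
`m`-form. On the tree's carriers: for `m ≥ 1`, `d ≥ m + 2`, `Y` a smooth hypersurface of degree
`d` in `ℙ^{m+1}_ℂ` (`Motives.IsSmoothHypersurface`: smooth projective geometrically irreducible
`m`-fold, reduced, closed-immersed onto `V₊(F)`, `F` irreducible homogeneous of degree `d`) and
`A` a Hodge model of `Y` (its carrier, with holomorphic atlas charted on `A.model ≅ ℂᵐ`, is an
analytification of `Y`, i.e. `Y_h` up to biholomorphism over `Y(ℂ)`, Serre GAGA §2), there is a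
complex `m`-form on `A.carrier` which is holomorphic in charts
(`Literature.Geometry.Kaehler.IsHolomorphicInCharts`: in every preferred chart the germ of an
analytic function valued in `ℂ`-multilinear alternating forms — Huybrechts, Def. 2.2.14) and
non-zero. (Analytically these forms are Griffiths' residues `Res_Y(PΩ/F)`, `deg P = d - m - 2`,
Voisin II, §6.1.3; a discharge on these carriers needs the Jacobian criterion for `V₊(F)`, the
comparison of `Y(ℂ)` with `{F = 0} ⊂ ℙ^{m+1}(ℂ)`, and the residue form in implicit-function
charts.) [cite: Hartshorne1977, II Example 8.20.3 and App. B Thm. 2.1]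
[cite: SerreGAGA1956, §3] [cite: VoisinHodgeII2003, §6.1.3] -/
def Hartshorne1977_hypersurface_geometricGenus_pos : Prop :=
  ∀ (m d : ℕ), 1 ≤ m → m + 2 ≤ d → ∀ (Y : Motives.SchemeOver ℂ), Motives.IsSmoothHypersurface m d Y →
    ∀ A : HodgeModel m Y, ∃ η : Literature.Geometry.Kaehler.MForm 𝓘(ℝ, A.model) A.carrier ℂ m,
      Literature.Geometry.Kaehler.IsHolomorphicInCharts η ∧ η ≠ 0

/-- **Reduction of `Hartshorne1977_hypersurface_exists_holomorphicTopForm` to the analytic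
geometric genus.** If every Hodge model of a smooth hypersurface `Y ⊂ ℙ^{m+1}_ℂ` of degree
`d ≥ m + 2` carries a non-zero `m`-form holomorphic in charts
(`Hartshorne1977_hypersurface_geometricGenus_pos`, Hartshorne II Ex. 8.20.3 + App. B Thm. 2.1),
then it carries a smooth, closed, non-zero `m`-form of type `(m,0)`: the carrier of a Hodge model
is a complex manifold of dimension `m` (`A.isAnalytification.finrank_eq`) with real `C^∞` atlas
(`A.isManifold_real`), and on such a manifold a holomorphic `m`-form is smooth, of type `(m,0)`
and closed (`Literature.Geometry.Kaehler.IsHolomorphicInCharts.isSmoothForm`, `.isOfType`,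
`.isClosedForm`; Voisin I, proof of Cor. 7.6, case `p = n`).
[cite: Hartshorne1977, II Example 8.20.3] [cite: VoisinHodgeI2002, Cor. 7.6 (proof, case p = n)] -/
theorem Hartshorne1977_hypersurface_exists_holomorphicTopForm_of_geometricGenus_pos
    (h : Hartshorne1977_hypersurface_geometricGenus_pos) :
    Hartshorne1977_hypersurface_exists_holomorphicTopForm := by
  intro m d hm hd Y hY A
  obtain ⟨η, hη, hne⟩ := h m d hm hd Y hY A
  exact ⟨η, hη.isSmoothForm, hη.isClosedForm A.isAnalytification.finrank_eq, hη.isOfType, hne⟩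

end Literature.AlgebraicGeometry.HodgeTheory

end
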